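/-
Copyright: lit-balaban Phase-2 proof seat p08 (gen 8).  Statement-level skeleton of a published paper; no proof claims beyond what
the kernel checks below.
-/
import Literature.MathematicalPhysics.QuantumFieldTheory.BalabanImbrieJaffe1984to88.BIJ85CurlyDkGradTorus

/-!
# `BalabanImbrieJaffe1984to88.BIJ85CurlyDkHolderTerm` — T. Bałaban, J. Imbrie, A. Jaffe, *Renormalization of the Higgs model: minimizers,
propagators and the stability of mean field theory*, Commun. Math. Phys. **97** (1985) 299–329 [BalabanImbrieJaffe1985]: Sect. 7.2,
p. 326, **the HÖLDER member of «𝒟_k has the same properties as G_k in [6I], Proposition 1.2» ON THE TORI FOR THE `𝒟_k` OF RECORD**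
(p11's `DkE P η_k^d L^k k`), file 1 of 3 (the scale-`j` term): the double difference of the Landau kernels at two fine sites `x ≠ x′`
and the scale-`j` term of `Δ_λ𝒟_k(⟨x, μ⟩, b″) − Δ_λ𝒟_k(⟨x′, μ⟩, b″)` — companions `BIJ85CurlyDkDecayTorus` (kernel), `BIJ85CurlyDkGradTorus`
(gradient), `BIJ85CurlyDkHolderSum`/`BIJ85CurlyDkHolderTorus` (files 2–3)

statement-level skeleton of published theorems with citation tags; proofs where landed; nothing here is a claim about the Yang–Mills mass gap

PDF held: `paper:balaban1985-cmp97-bij-higgs-minimizers` (journal page = PDF page + 298), p. 312 [PDF 14], pp. 325–326 [PDF 27–28]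
(text layer `~/.lit/texts/paper-balaban1985-cmp97-bij-higgs-minimizers/p0014.txt`, `p0027.txt`, `p0028.txt`, re-read this session);
[6I] = [Balaban1984PropagatorsI] Prop. 1.2 (tree name `Balaban1983to89.B5.Prop12Printed`).

CITATION HEADER (lean-in-tree rule).  Part of the lit-balaban TYPED SKELETON (HOME `run/shared/lean/pub/lit-balaban/`), Phase-2 proof
seat p08 (gen 8), unit `lit-balaban-p08`; WHAT IS REPRODUCED = the located sentence of SKELETON row **C1.Eq7.2.4** (owner r15, referee
ref-5) *"the operators 𝒟_k have the properties of G_k in [6I] Prop 1.2 (exponential decay, singularities on the diagonal) by (4.4.4)"*,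
HÖLDER MEMBER ([6I] Proposition 1.2 / (7.2.2) bound `G`, `∇G` and the Hölder quotient of `∇G` of order `α < 1`), for the `𝒟_k` of record
of rows **C1.Eq4.4.4** / **C2.Eq2.12**, kind «model instance».  TAKING line HOME/STATUS.md 2026-08-21T19:42:18Z.  Decls used BY NAME
(nothing restated): p08 g8's `BIJ85CurlyDkGradTorus.dkKernel_shift_sub_eq_sum` (p301540); p08 g7's
`BIJ88Ineq217Ineq722Torus.ofLp_HkE_single`, `BIJ88Decay216Torus.triple_sum_le`; r18's `BIJ88Decay216Native.abs_inner_cE_ambient_le`;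
p09's `torusRep`/`distEU`; the tree's `supDist_eq_zero_iff`.

THE PRINTED TEXT (p. 326 [PDF 28], verbatim): *"The operators 𝒟_k have the same properties as the operators G_k in [6I], Proposition 1.2,
with exponential decay but singularities on the diagonal. These properties follow from (4.4.4) and the above estimates on H_k, C^{(k)}."*;
(7.2.2) p. 325: *"there exists δ > 0 and for 0 ≦ α < 1 a constant M = M(α) < ∞ such that for |x − x′| ≦ 1, |H_{k,μν}(x,y)| +
|∇H_{k,μν}(x,y)| + |x − x′|^{−α}|∇H_{k,μν}(x,y) − ∇H_{k,μν}(x′,y)| ≦ Me^{−δ|x−y|}. (7.2.2)"*; (7.2.3) p. 325 *"|C^{(k)}_{μν}(x,y)| ≦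
Me^{−δ|x−y|}"*; (4.4.4) p. 312 *"𝒟_k = Σ_{j=0}^{k−1} H_jC^{(j)}H_j*"*.

THE TORUS DATA (all in the tree; as in the companion files): tori `Balaban1983to89.Setup`/`Params` (`d ≥ 2`, standing range
`k ≤ m + K`, `η_k = L^{−k}`); fine sites `x, x′ : Site P 0`, `η`-bonds `⟨x, μ⟩ : PBond P 0`; `ℓ^∞` distances `|·|_∞/L^k` in the unit of
`T₁^{(k)}` (`supDist`); the kernel `𝒟_k(b, b″) := (𝒟_ke_{b″})(b)` of p11's `DkE P η_k^d L^k k` and its `η`-difference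
`Δ_λ𝒟_k(⟨x, μ⟩, b″) := 𝒟_k(⟨x+e_λ, μ⟩, b″) − 𝒟_k(⟨x, μ⟩, b″)`; the scale-`j` Landau kernels `H_{j,μν}(x; y)` of p09's
`torusRep P j (deltaAData …)` and the three members of (7.2.2) in the shape of p09's carrier `torusKernelData` (`gradH`, `gradHDiff` =
sup over `λ` of `L^j`·forward differences; `distEta = |x − x′|_∞/L^j`); the unit-lattice matrices of p11's `CE P η_j^d L^j j`.

WHAT IS PROVED (0 `sorry`, standard axioms; theorems only — proof lane; every `d ≥ 2`):
* §1 **`dkKernel_secondDiff_eq_sum`**: `Δ_λ𝒟_k(⟨x, μ⟩, b″) − Δ_λ𝒟_k(⟨x′, μ⟩, b″) = Σ_{j<k}Σ_{b₁,b₂} (Δ_λH_j(⟨x, μ⟩, b₁) − Δ_λH_j(⟨x′, μ⟩, b₁))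
  C^{(j)}(b₁, b₂)H_j(b″, b₂)` (any weights).
* §2 **`abs_secondDiff_H_le`**: with `r = |x − x′|_∞/L^j`, `L^j|Δ_λH_{j,μν}(x; y) − Δ_λH_{j,μν}(x′; y)| ≤ r^α(M + M_α)(e^{−δ|x−y|} +
  e^{−δ|x′−y|})` — the Hölder member for `r ≤ 1`, the gradient member twice and `r^α ≥ 1` for `r > 1`; **`abs_holderTermDk_le`**: the
  scale-`j` term is at most `L^{−j}r^α(M + M_α)M·M_C(L^{k−j})^{d−2}·d²e^{a/2}K(a)²·(e^{−a|x−b″₋|_∞/L^j} + e^{−a|x′−b″₋|_∞/L^j})`,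
  `a = min(δ, δ_C)/2`.
HONEST SCOPE.  (i) Per-scale statements only; the multiscale sum and the assembly from `B5.Prop12Printed` are files 2–3.  (ii) The second
difference is taken in the first argument of the kernel, same direction `μ` at `x` and `x′`; no short-distance statement.  (iii) `U = 1`, real
abelian fields, torus, standing range.  (iv) No `def`, no new named fact, nothing restated; NOT summit progress.  Unit `lit-balaban-p08`
(literature-prover-lit-balaban-p08-g8-0), 2026-08-21.
-/

open scoped BigOperators RealInnerProductSpace

namespace Literature.MathematicalPhysics.QuantumFieldTheory.BalabanImbrieJaffe1984to88.BIJ85CurlyDkHolderTerm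

open Balaban1983to89 hiding Site Plaq
open Balaban1983to89.LatticeFieldCalculus
open Balaban1983to89.B3TorusRadialSums (supDist_eq_zero_iff)
open BIJ88SigmaKernelDkTorus BIJ88Ineq217Ineq722Torus BIJ88Decay216Torus
open BIJ85AxialPropagator411 BIJ85Prop521Torus BIJ85Prop522Torus BIJ85Sigma422Eta
open BIJ85Sect7Statements BIJ85Ineq722Torus BIJ85Eq721MinimizerKernel
open BIJ85Ineq722DeltaA (deltaAData ineq722_deltaA_of_prop12Printed)
open BIJ85Ineq722ProofPart2 (settingOf)
open BIJ88Decay216Native (abs_inner_cE_ambient_le)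
open BIJ88Decay216Prop12 (ineq723_CE_torus)
open BIJ85CurlyDkGradTorus (dkKernel_shift_sub_eq_sum)
-- inside this namespace the bare `Site`/`Plaq` are the `ℤ^d` carriers of the QFT root; the torus ones are renamed:
open Balaban1983to89 renaming Site → TSite, Plaq → TPlaq

noncomputable section

variable {P : Params}

/-! ## §1  The second difference: `η`-difference in the first argument at two fine sites `x ≠ x′` -/

/-- **THE DIFFERENCE OF THE `η`-DIFFERENCES OF `𝒟_k(·, b″)` AT TWO SITES** through the corresponding double differences of the Landau
kernels: `Δ_λ𝒟_k(⟨x, μ⟩, b″) − Δ_λ𝒟_k(⟨x′, μ⟩, b″) = Σ_{j<k}Σ_{b₁,b₂} (Δ_λH_j(⟨x, μ⟩, b₁) − Δ_λH_j(⟨x′, μ⟩, b₁))·C^{(j)}(b₁, b₂)·H_j(b″, b₂)`,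
`Δ_λF(⟨x, μ⟩) = F(⟨x+e_λ, μ⟩) − F(⟨x, μ⟩)` ((4.4.4) entrywise; any weights). [cite: BalabanImbrieJaffe1985, (4.4.4) p.312] -/
theorem dkKernel_secondDiff_eq_sum (w c : ℝ) (k : ℕ) (x x' : TSite P 0) (μ lam : Fin P.d) (b'' : PBond P 0) :
    (DkE P w c k (toE P (Pi.single b'' 1)) ⟨x.shift lam, μ⟩ - DkE P w c k (toE P (Pi.single b'' 1)) ⟨x, μ⟩) -
        (DkE P w c k (toE P (Pi.single b'' 1)) ⟨x'.shift lam, μ⟩ - DkE P w c k (toE P (Pi.single b'' 1)) ⟨x', μ⟩) =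
      ∑ j ∈ Finset.range k, ∑ b₁ : PBond P j, ∑ b₂ : PBond P j,
        ((HkE P w c j (toEj P j (Pi.single b₁ 1)) ⟨x.shift lam, μ⟩ - HkE P w c j (toEj P j (Pi.single b₁ 1)) ⟨x, μ⟩) -
            (HkE P w c j (toEj P j (Pi.single b₁ 1)) ⟨x'.shift lam, μ⟩ - HkE P w c j (toEj P j (Pi.single b₁ 1)) ⟨x', μ⟩)) *
          ⟪toEj P j (Pi.single b₁ 1), CE P w c j (toEj P j (Pi.single b₂ 1))⟫ *
          HkE P w c j (toEj P j (Pi.single b₂ 1)) b'' := by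
  rw [dkKernel_shift_sub_eq_sum w c k ⟨x, μ⟩ b'' lam, dkKernel_shift_sub_eq_sum w c k ⟨x', μ⟩ b'' lam, ← Finset.sum_sub_distrib]
  refine Finset.sum_congr rfl fun j _ => ?_
  rw [← Finset.sum_sub_distrib]
  refine Finset.sum_congr rfl fun b₁ _ => ?_
  rw [← Finset.sum_sub_distrib]
  refine Finset.sum_congr rfl fun b₂ _ => ?_
  ring

/-! ## §2  The double difference of `H_j`: the Hölder member of (7.2.2) near, the gradient member far -/

/-- `0 < L^n`. [folklore] -/
private theorem cast_pow_L_pos' (n : ℕ) : (0 : ℝ) < (P.L : ℝ) ^ n := pow_pos P.cast_L_pos n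

/-- **THE DOUBLE DIFFERENCE OF THE LANDAU KERNEL AT TWO SITES `x ≠ x′`**: with `r = |x − x′|_∞/L^j` (the distance in the unit of the scale-`j`
lattice), `L^j·|Δ_λH_{j,μν}(x; y) − Δ_λH_{j,μν}(x′; y)| ≤ r^α·(M + M_α)(e^{−δ|x−y|} + e^{−δ|x′−y|})` — for `r ≤ 1` by the HÖLDER member of
(7.2.2) (`|x − x′|^{−α}|∇H(x, y) − ∇H(x′, y)| ≤ M_αe^{−δ|x−y|}`), for `r > 1` by the gradient member twice and `r^α ≥ 1`.
[cite: BalabanImbrieJaffe1985, (7.2.2) p.325] -/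
theorem abs_secondDiff_H_le {j : ℕ} (hj : j ≤ P.m + P.K) {a : ℝ} {δ M Mα α : ℝ} (hM : 0 ≤ M) (hMα : 0 ≤ Mα) (hα : 0 ≤ α)
    (hB : ∀ (μ ν : Fin P.d) (x : TSite P 0) (y : TSite P j),
      ‖fun lam : Fin P.d => (P.L : ℝ) ^ j *
          ((torusRep P j (deltaAData hj a)).H (x.shift lam, μ) (y, ν) - (torusRep P j (deltaAData hj a)).H (x, μ) (y, ν))‖ ≤
        M * Real.exp (-(δ * distEU P j x y)))
    (hHol : ∀ (μ ν : Fin P.d) (x x' : TSite P 0) (y : TSite P j), x ≠ x' → (supDist x x' : ℝ) / (P.L : ℝ) ^ j ≤ 1 →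
      ((supDist x x' : ℝ) / (P.L : ℝ) ^ j) ^ (-α) *
          ‖fun lam : Fin P.d => (P.L : ℝ) ^ j * ((torusRep P j (deltaAData hj a)).H (x.shift lam, μ) (y, ν) -
              (torusRep P j (deltaAData hj a)).H (x, μ) (y, ν)) -
            (P.L : ℝ) ^ j * ((torusRep P j (deltaAData hj a)).H (x'.shift lam, μ) (y, ν) -
              (torusRep P j (deltaAData hj a)).H (x', μ) (y, ν))‖ ≤
        Mα * Real.exp (-(δ * distEU P j x y)))
    {x x' : TSite P 0} (hne : x ≠ x') (μ ν lam : Fin P.d) (y : TSite P j) :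
    (P.L : ℝ) ^ j * |((torusRep P j (deltaAData hj a)).H (x.shift lam, μ) (y, ν) - (torusRep P j (deltaAData hj a)).H (x, μ) (y, ν)) -
        ((torusRep P j (deltaAData hj a)).H (x'.shift lam, μ) (y, ν) - (torusRep P j (deltaAData hj a)).H (x', μ) (y, ν))| ≤
      ((supDist x x' : ℝ) / (P.L : ℝ) ^ j) ^ α *
        ((M + Mα) * (Real.exp (-(δ * distEU P j x y)) + Real.exp (-(δ * distEU P j x' y)))) := by
  set R := torusRep P j (deltaAData hj a) with hR
  have hLj : 0 < (P.L : ℝ) ^ j := cast_pow_L_pos' j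
  set r : ℝ := (supDist x x' : ℝ) / (P.L : ℝ) ^ j with hr
  have hS : 0 < (supDist x x' : ℝ) := by
    have h0 : supDist x x' ≠ 0 := fun h => hne ((supDist_eq_zero_iff x x').1 h)
    exact_mod_cast Nat.pos_of_ne_zero h0
  have hr0 : 0 < r := div_pos hS hLj
  have hex : 0 < Real.exp (-(δ * distEU P j x y)) := Real.exp_pos _
  have hex' : 0 < Real.exp (-(δ * distEU P j x' y)) := Real.exp_pos _
  -- the gradient member, componentwise, at `x` and at `x′`
  have hg : ∀ z : TSite P 0, (P.L : ℝ) ^ j * |R.H (z.shift lam, μ) (y, ν) - R.H (z, μ) (y, ν)| ≤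
      M * Real.exp (-(δ * distEU P j z y)) := by
    intro z
    have h1 := (norm_le_pi_norm (fun lam' : Fin P.d => (P.L : ℝ) ^ j *
      (R.H (z.shift lam', μ) (y, ν) - R.H (z, μ) (y, ν))) lam).trans (hB μ ν z y)
    rwa [Real.norm_eq_abs, abs_mul, abs_of_pos hLj] at h1
  by_cases hr1 : r ≤ 1
  · -- near: the Hölder member
    have h := hHol μ ν x x' y hne hr1
    have hrα : 0 < r ^ α := Real.rpow_pos_of_pos hr0 α
    rw [← hr, Real.rpow_neg hr0.le, inv_mul_le_iff₀ hrα] at h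
    have h1 := (norm_le_pi_norm (fun lam' : Fin P.d => (P.L : ℝ) ^ j * (R.H (x.shift lam', μ) (y, ν) - R.H (x, μ) (y, ν)) -
      (P.L : ℝ) ^ j * (R.H (x'.shift lam', μ) (y, ν) - R.H (x', μ) (y, ν))) lam).trans h
    rw [Real.norm_eq_abs, ← mul_sub, abs_mul, abs_of_pos hLj] at h1
    refine h1.trans (mul_le_mul_of_nonneg_left ?_ hrα.le)
    nlinarith [hM, hMα, hex, hex']
  · -- far: the gradient member twice, `r^α ≥ 1`
    have hr1' : 1 ≤ r := le_of_lt (not_le.1 hr1)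
    have hrα : 1 ≤ r ^ α := Real.one_le_rpow hr1' hα
    have h1 := hg x
    have h2 := hg x'
    calc (P.L : ℝ) ^ j * |(R.H (x.shift lam, μ) (y, ν) - R.H (x, μ) (y, ν)) - (R.H (x'.shift lam, μ) (y, ν) - R.H (x', μ) (y, ν))|
        ≤ (P.L : ℝ) ^ j * (|R.H (x.shift lam, μ) (y, ν) - R.H (x, μ) (y, ν)| + |R.H (x'.shift lam, μ) (y, ν) - R.H (x', μ) (y, ν)|) :=
          mul_le_mul_of_nonneg_left (abs_sub _ _) hLj.le
      _ ≤ M * Real.exp (-(δ * distEU P j x y)) + M * Real.exp (-(δ * distEU P j x' y)) := by rw [mul_add]; exact add_le_add h1 h2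
      _ ≤ 1 * ((M + Mα) * (Real.exp (-(δ * distEU P j x y)) + Real.exp (-(δ * distEU P j x' y)))) := by
          rw [one_mul]; nlinarith [hM, hMα, hex, hex']
      _ ≤ _ := mul_le_mul_of_nonneg_right hrα (by positivity)

/-- `Σ_b f(b₋) = d·Σ_y f(y)` on `T^{(j)}`. [folklore] -/
private theorem sum_bond_src {j : ℕ} (f : TSite P j → ℝ) : ∑ b : PBond P j, f b.src = (P.d : ℝ) * ∑ y : TSite P j, f y := by
  rw [← Fintype.sum_equiv (LatticeFieldCalculus.bondEquiv (P := P) (j := j)) (fun q : TSite P j × Fin P.d => f q.1) _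
    (fun q => rfl), Fintype.sum_prod_type]
  simp only [Finset.sum_const, Finset.card_univ, Fintype.card_fin, nsmul_eq_mul]
  rw [Finset.mul_sum]

/-- p08 g7's three-kernel lattice sum `triple_sum_le` read over unit bonds (a factor `d²` for the directions). [folklore] -/
private theorem sum_bond_triple_le {j : ℕ} (hj : j ≤ P.m + P.K) {δ δC : ℝ} (hδ : 0 < δ) (hδC : 0 < δC) (z x₂ : TSite P 0) :
    ∑ b₁ : PBond P j, ∑ b₂ : PBond P j, Real.exp (-(δ * distEU P j z b₁.src)) * Real.exp (-(δC * (supDist b₁.src b₂.src : ℝ))) *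
        Real.exp (-(δ * distEU P j x₂ b₂.src)) ≤
      (P.d : ℝ) ^ 2 * (Real.exp (min δ δC / 2 / 2) * ((2 * (1 + P.d / (min δ δC / 2))) ^ P.d) ^ 2) *
        Real.exp (-(min δ δC / 2 * ((supDist z x₂ : ℝ) / (P.L : ℝ) ^ j))) := by
  rw [sum_bond_src (fun y => ∑ b₂ : PBond P j, Real.exp (-(δ * distEU P j z y)) * Real.exp (-(δC * (supDist y b₂.src : ℝ))) *
    Real.exp (-(δ * distEU P j x₂ b₂.src)))]
  have e : ∀ y : TSite P j, ∑ b₂ : PBond P j, Real.exp (-(δ * distEU P j z y)) * Real.exp (-(δC * (supDist y b₂.src : ℝ))) *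
      Real.exp (-(δ * distEU P j x₂ b₂.src)) = (P.d : ℝ) * ∑ y' : TSite P j, Real.exp (-(δ * distEU P j z y)) *
        Real.exp (-(δC * (supDist y y' : ℝ))) * Real.exp (-(δ * distEU P j x₂ y')) := fun y =>
    sum_bond_src (fun y' => Real.exp (-(δ * distEU P j z y)) * Real.exp (-(δC * (supDist y y' : ℝ))) *
      Real.exp (-(δ * distEU P j x₂ y')))
  simp only [e]
  rw [← Finset.mul_sum, ← mul_assoc, ← sq, mul_assoc]
  exact mul_le_mul_of_nonneg_left (triple_sum_le hj hδ hδC z x₂) (by positivity)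

/-- **THE SCALE-`j` TERM OF THE SECOND DIFFERENCE** (`j ≤ k`, `j ≤ m + K`, `x ≠ x′`, every `d ≥ 2`): with `r = |x − x′|_∞/L^j`, the term is at
most `L^{−j}·r^α·(M + M_α)M·M_C(L^{k−j})^{d−2}·d²e^{a/2}K(a)²·(e^{−a|x−b″₋|_∞/L^j} + e^{−a|x′−b″₋|_∞/L^j})`, `a = min(δ, δ_C)/2`, from the sup,
gradient and Hölder members of (7.2.2) for `H_j` and the unit-lattice (7.2.3). [cite: BalabanImbrieJaffe1985, (4.4.4) p.312] -/
theorem abs_holderTermDk_le (hd : 2 ≤ P.d) {k j : ℕ} (hj : j ≤ P.m + P.K) (hjk : j ≤ k) {a : ℝ} (ha : 0 < a)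
    {δ M Mα α δC MC : ℝ} (hδ : 0 < δ) (hδC : 0 < δC) (hMα : 0 ≤ Mα) (hα : 0 ≤ α)
    (hH : ∀ (μ ν : Fin P.d) (x : TSite P 0) (y : TSite P j),
      |(torusRep P j (deltaAData hj a)).H (x, μ) (y, ν)| ≤ M * Real.exp (-(δ * distEU P j x y)))
    (hB : ∀ (μ ν : Fin P.d) (x : TSite P 0) (y : TSite P j),
      ‖fun lam : Fin P.d => (P.L : ℝ) ^ j *
          ((torusRep P j (deltaAData hj a)).H (x.shift lam, μ) (y, ν) - (torusRep P j (deltaAData hj a)).H (x, μ) (y, ν))‖ ≤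
        M * Real.exp (-(δ * distEU P j x y)))
    (hHol : ∀ (μ ν : Fin P.d) (x x' : TSite P 0) (y : TSite P j), x ≠ x' → (supDist x x' : ℝ) / (P.L : ℝ) ^ j ≤ 1 →
      ((supDist x x' : ℝ) / (P.L : ℝ) ^ j) ^ (-α) *
          ‖fun lam : Fin P.d => (P.L : ℝ) ^ j * ((torusRep P j (deltaAData hj a)).H (x.shift lam, μ) (y, ν) -
              (torusRep P j (deltaAData hj a)).H (x, μ) (y, ν)) -
            (P.L : ℝ) ^ j * ((torusRep P j (deltaAData hj a)).H (x'.shift lam, μ) (y, ν) -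
              (torusRep P j (deltaAData hj a)).H (x', μ) (y, ν))‖ ≤
        Mα * Real.exp (-(δ * distEU P j x y)))
    (hC : ∀ b₁ b₂ : PBond P j, |⟪toEj P j (Pi.single b₁ 1),
      CE P ((P.eta j) ^ P.d) ((P.L : ℝ) ^ j) j (toEj P j (Pi.single b₂ 1))⟫| ≤ MC * Real.exp (-(δC * (supDist b₁.src b₂.src : ℝ))))
    {x x' : TSite P 0} (hne : x ≠ x') (μ lam : Fin P.d) (b'' : PBond P 0) :
    |∑ b₁ : PBond P j, ∑ b₂ : PBond P j,
        ((HkE P ((P.eta k) ^ P.d) ((P.L : ℝ) ^ k) j (toEj P j (Pi.single b₁ 1)) ⟨x.shift lam, μ⟩ -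
              HkE P ((P.eta k) ^ P.d) ((P.L : ℝ) ^ k) j (toEj P j (Pi.single b₁ 1)) ⟨x, μ⟩) -
            (HkE P ((P.eta k) ^ P.d) ((P.L : ℝ) ^ k) j (toEj P j (Pi.single b₁ 1)) ⟨x'.shift lam, μ⟩ -
              HkE P ((P.eta k) ^ P.d) ((P.L : ℝ) ^ k) j (toEj P j (Pi.single b₁ 1)) ⟨x', μ⟩)) *
          ⟪toEj P j (Pi.single b₁ 1), CE P ((P.eta k) ^ P.d) ((P.L : ℝ) ^ k) j (toEj P j (Pi.single b₂ 1))⟫ *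
          HkE P ((P.eta k) ^ P.d) ((P.L : ℝ) ^ k) j (toEj P j (Pi.single b₂ 1)) b''| ≤
      ((P.L : ℝ) ^ j)⁻¹ * ((supDist x x' : ℝ) / (P.L : ℝ) ^ j) ^ α *
        ((M + Mα) * M * (MC * ((P.L : ℝ) ^ (k - j)) ^ (P.d - 2)) *
          ((P.d : ℝ) ^ 2 * (Real.exp (min δ δC / 2 / 2) * ((2 * (1 + P.d / (min δ δC / 2))) ^ P.d) ^ 2)) *
          (Real.exp (-(min δ δC / 2 * ((supDist x b''.src : ℝ) / (P.L : ℝ) ^ j))) +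
            Real.exp (-(min δ δC / 2 * ((supDist x' b''.src : ℝ) / (P.L : ℝ) ^ j))))) := by
  set R := torusRep P j (deltaAData hj a) with hR
  have hw : 0 < (P.eta k) ^ P.d := pow_pos (eta_pos P k) _
  have hc : (P.L : ℝ) ^ k ≠ 0 := (cast_pow_L_pos' k).ne'
  have hLj : 0 < (P.L : ℝ) ^ j := cast_pow_L_pos' j
  have hM : 0 ≤ M := by
    have h := hH ⟨0, P.hd⟩ ⟨0, P.hd⟩ default default
    exact (mul_nonneg_iff_of_pos_right (Real.exp_pos _)).1 ((abs_nonneg _).trans h)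
  set ρ : ℝ := ((supDist x x' : ℝ) / (P.L : ℝ) ^ j) ^ α with hρ
  have hρ0 : 0 ≤ ρ := Real.rpow_nonneg (div_nonneg (Nat.cast_nonneg _) hLj.le) α
  set K : ℝ := (P.d : ℝ) ^ 2 * (Real.exp (min δ δC / 2 / 2) * ((2 * (1 + P.d / (min δ δC / 2))) ^ P.d) ^ 2) with hK
  have hMC : 0 ≤ MC := by
    have h := hC ⟨default, ⟨0, P.hd⟩⟩ ⟨default, ⟨0, P.hd⟩⟩
    exact (mul_nonneg_iff_of_pos_right (Real.exp_pos _)).1 ((abs_nonneg _).trans h)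
  set MC' : ℝ := MC * ((P.L : ℝ) ^ (k - j)) ^ (P.d - 2) with hMC'
  have hMC'0 : 0 ≤ MC' := mul_nonneg hMC (pow_pos (cast_pow_L_pos' _) _).le
  -- the entries
  have hent : ∀ (z : TSite P 0) (κ : Fin P.d) (b₁ : PBond P j),
      HkE P ((P.eta k) ^ P.d) ((P.L : ℝ) ^ k) j (toEj P j (Pi.single b₁ 1)) ⟨z, κ⟩ = R.H (z, κ) (b₁.src, b₁.dir) :=
    fun z κ b₁ => ofLp_HkE_single hj hc hw ha b₁ z κ
  have hH' : ∀ b₂ : PBond P j, |HkE P ((P.eta k) ^ P.d) ((P.L : ℝ) ^ k) j (toEj P j (Pi.single b₂ 1)) b''| ≤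
      M * Real.exp (-(δ * distEU P j b''.src b₂.src)) := by
    intro b₂
    rw [show b'' = ⟨b''.src, b''.dir⟩ from rfl, hent]
    exact hH _ _ _ _
  have hE : ∀ b₁ : PBond P j,
      |(HkE P ((P.eta k) ^ P.d) ((P.L : ℝ) ^ k) j (toEj P j (Pi.single b₁ 1)) ⟨x.shift lam, μ⟩ -
            HkE P ((P.eta k) ^ P.d) ((P.L : ℝ) ^ k) j (toEj P j (Pi.single b₁ 1)) ⟨x, μ⟩) -
          (HkE P ((P.eta k) ^ P.d) ((P.L : ℝ) ^ k) j (toEj P j (Pi.single b₁ 1)) ⟨x'.shift lam, μ⟩ -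
            HkE P ((P.eta k) ^ P.d) ((P.L : ℝ) ^ k) j (toEj P j (Pi.single b₁ 1)) ⟨x', μ⟩)| ≤
        ((P.L : ℝ) ^ j)⁻¹ * ρ * ((M + Mα) * (Real.exp (-(δ * distEU P j x b₁.src)) + Real.exp (-(δ * distEU P j x' b₁.src)))) := by
    intro b₁
    rw [hent, hent, hent, hent, mul_assoc, le_inv_mul_iff₀ hLj]
    exact abs_secondDiff_H_le hj hM hMα hα hB hHol hne μ b₁.dir lam b₁.src
  have hC' := abs_inner_cE_ambient_le hd hjk hC
  -- termwise bound
  have hpt : ∀ b₁ b₂ : PBond P j,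
      |((HkE P ((P.eta k) ^ P.d) ((P.L : ℝ) ^ k) j (toEj P j (Pi.single b₁ 1)) ⟨x.shift lam, μ⟩ -
              HkE P ((P.eta k) ^ P.d) ((P.L : ℝ) ^ k) j (toEj P j (Pi.single b₁ 1)) ⟨x, μ⟩) -
            (HkE P ((P.eta k) ^ P.d) ((P.L : ℝ) ^ k) j (toEj P j (Pi.single b₁ 1)) ⟨x'.shift lam, μ⟩ -
              HkE P ((P.eta k) ^ P.d) ((P.L : ℝ) ^ k) j (toEj P j (Pi.single b₁ 1)) ⟨x', μ⟩)) *
          ⟪toEj P j (Pi.single b₁ 1), CE P ((P.eta k) ^ P.d) ((P.L : ℝ) ^ k) j (toEj P j (Pi.single b₂ 1))⟫ *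
          HkE P ((P.eta k) ^ P.d) ((P.L : ℝ) ^ k) j (toEj P j (Pi.single b₂ 1)) b''| ≤
        ((P.L : ℝ) ^ j)⁻¹ * ρ * ((M + Mα) * M * MC') *
          (Real.exp (-(δ * distEU P j x b₁.src)) * Real.exp (-(δC * (supDist b₁.src b₂.src : ℝ))) *
              Real.exp (-(δ * distEU P j b''.src b₂.src)) +
            Real.exp (-(δ * distEU P j x' b₁.src)) * Real.exp (-(δC * (supDist b₁.src b₂.src : ℝ))) *
              Real.exp (-(δ * distEU P j b''.src b₂.src))) := by
    intro b₁ b₂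
    rw [abs_mul, abs_mul]
    have h1 := hE b₁
    have h2 := hH' b₂
    have h3 := hC' b₁ b₂
    rw [← hMC'] at h3
    calc _ ≤ (((P.L : ℝ) ^ j)⁻¹ * ρ * ((M + Mα) * (Real.exp (-(δ * distEU P j x b₁.src)) +
            Real.exp (-(δ * distEU P j x' b₁.src))))) * (MC' * Real.exp (-(δC * (supDist b₁.src b₂.src : ℝ)))) *
          (M * Real.exp (-(δ * distEU P j b''.src b₂.src))) :=
          mul_le_mul (mul_le_mul h1 h3 (abs_nonneg _) (by positivity)) h2 (abs_nonneg _) (by positivity)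
      _ = _ := by ring
  have hT := sum_bond_triple_le hj hδ hδC x b''.src
  have hT' := sum_bond_triple_le hj hδ hδC x' b''.src
  rw [← hK] at hT hT'
  calc _ ≤ ∑ b₁ : PBond P j, ∑ b₂ : PBond P j, ((P.L : ℝ) ^ j)⁻¹ * ρ * ((M + Mα) * M * MC') *
          (Real.exp (-(δ * distEU P j x b₁.src)) * Real.exp (-(δC * (supDist b₁.src b₂.src : ℝ))) *
              Real.exp (-(δ * distEU P j b''.src b₂.src)) +
            Real.exp (-(δ * distEU P j x' b₁.src)) * Real.exp (-(δC * (supDist b₁.src b₂.src : ℝ))) *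
              Real.exp (-(δ * distEU P j b''.src b₂.src))) :=
        (Finset.abs_sum_le_sum_abs _ _).trans (Finset.sum_le_sum fun b₁ _ =>
          (Finset.abs_sum_le_sum_abs _ _).trans (Finset.sum_le_sum fun b₂ _ => hpt b₁ b₂))
    _ = ((P.L : ℝ) ^ j)⁻¹ * ρ * ((M + Mα) * M * MC') *
          ((∑ b₁ : PBond P j, ∑ b₂ : PBond P j, Real.exp (-(δ * distEU P j x b₁.src)) *
              Real.exp (-(δC * (supDist b₁.src b₂.src : ℝ))) * Real.exp (-(δ * distEU P j b''.src b₂.src))) +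
            ∑ b₁ : PBond P j, ∑ b₂ : PBond P j, Real.exp (-(δ * distEU P j x' b₁.src)) *
              Real.exp (-(δC * (supDist b₁.src b₂.src : ℝ))) * Real.exp (-(δ * distEU P j b''.src b₂.src))) := by
        rw [← Finset.sum_add_distrib, Finset.mul_sum]
        refine Finset.sum_congr rfl fun b₁ _ => ?_
        rw [← Finset.sum_add_distrib, Finset.mul_sum]
    _ ≤ ((P.L : ℝ) ^ j)⁻¹ * ρ * ((M + Mα) * M * MC') *
          (K * Real.exp (-(min δ δC / 2 * ((supDist x b''.src : ℝ) / (P.L : ℝ) ^ j))) +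
            K * Real.exp (-(min δ δC / 2 * ((supDist x' b''.src : ℝ) / (P.L : ℝ) ^ j)))) :=
        mul_le_mul_of_nonneg_left (add_le_add hT hT') (by positivity)
    _ = _ := by ring

end

end Literature.MathematicalPhysics.QuantumFieldTheory.BalabanImbrieJaffe1984to88.BIJ85CurlyDkHolderTerm
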